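import Mathlib
import Summits.ValiantsHypothesis.ValiantsHypothesis.Theorems.NewtonUnitEquationsNewtonTauWeakK3Defs

/-!
# `NewtonTauWeak` (stmt-ValiantsHypothesis-5904), stub `fixedKCoincidence_t2_K3`: lines of an exponent list and
# the FLIP IDENTITY in the Laurent algebra

Helper file of the proof of the `K = 3` sub-stub `fixedKCoincidence_t2_K3` of `stub_binomialNewtonTauCommon`
(line `binomial-normal-form`; siege variation "polynomial identity route").
* `exists_line_structure`: the nonzero exponents `d_j ∈ ℕ²` group into `s ≤ N` LINES with primitive generators
  `q_e` (pairwise non-parallel), `d_j = g_j • q_{cl j}`, `g_j ≥ 1` (primitive vector = exponent divided by the gcd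
  of its coordinates; two parallel primitive vectors of `ℕ²` coincide).
* `flip_identity` (`Cruxes/NewtonTauWeak/Lines/binomial-normal-form-ltc.md` §2, as a ring identity in
  `ℂ[ℤ²]`): for ANY set `SL` of lines declared "flipped", a scalar multiple of a product of binomials
  `1 - ρ_j X^{d_j}` over the list equals `κ · X^{P} · Π_e U_e(X^{E_e})` with `E_e = ∓ q_e`, corner
  `P = Σ_{flipped live j} d_j`, and univariate LINE FACTORS `U_e = Π_{live j on e} (1 + ρ̃_j s^{g_j})`,
  `ρ̃_j = (-ρ_j)⁻¹` on flipped lines (`1 - ρ X^d = (-ρ X^d)(1 + (-ρ)⁻¹ X^{-d})`) and `-ρ_j` otherwise; the line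
  factors have constant term `1` (`coeff_lineFactor_zero`) and degree at most the multiplicity of the line.
No definitions (all objects inlined). [folklore; this line]
-/

set_option linter.dupNamespace false

noncomputable section

open scoped BigOperators Polynomial

namespace Summit.ValiantsHypothesis.ValiantsHypothesis.Theorems.NewtonUnitEquationsNewtonTauWeak

open Summit.ValiantsHypothesis.ValiantsHypothesis.Theorems.NewtonTauWeakK3

namespace K3Pi

/-! ## Primitive vectors and lines -/

/-- Two coprime pairs of natural numbers spanning parallel vectors are equal. [folklore] -/
theorem eq_of_coprime_of_parallel {a b a' b' : ℕ} (h : Nat.Coprime a b) (h' : Nat.Coprime a' b')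
    (hpar : a * b' = b * a') : a = a' ∧ b = b' := by
  have ha : a = a' := by
    apply Nat.dvd_antisymm
    · exact h.dvd_of_dvd_mul_left ⟨b', hpar.symm⟩
    · exact h'.dvd_of_dvd_mul_left ⟨b, by rw [mul_comm b' a, hpar, mul_comm]⟩
  subst ha
  refine ⟨rfl, ?_⟩
  rcases Nat.eq_zero_or_pos a with h0 | hpos
  · subst h0
    rw [Nat.coprime_zero_left] at h h'
    rw [h, h']
  · exact (Nat.eq_of_mul_eq_mul_left hpos (by rw [hpar, mul_comm])).symm

/-- **Lines of an exponent list.** If some exponent is nonzero, the nonzero exponents `d_j ∈ ℕ²` are positive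
multiples `g_j • q_e` of `s ≤ N` pairwise non-parallel nonzero vectors `q_e`, every line being the line of some
exponent. [folklore] -/
theorem exists_line_structure {N : ℕ} (d : Fin N → Fin 2 →₀ ℕ) (hex : ∃ j, d j ≠ 0) :
    ∃ s : ℕ, ∃ q : Fin s → (Fin 2 →₀ ℕ), ∃ cl : Fin N → Fin s, ∃ g : Fin N → ℕ,
      s ≤ N ∧ (∀ e, q e ≠ 0) ∧ (∀ e, ∃ j, d j ≠ 0 ∧ cl j = e) ∧
      (∀ j, d j ≠ 0 → 1 ≤ g j ∧ d j = g j • q (cl j)) ∧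
      (∀ e e', e ≠ e' → (q e) 0 * (q e') 1 ≠ (q e) 1 * (q e') 0) := by
  classical
  -- primitive vector and multiplicity
  let gc : (Fin 2 →₀ ℕ) → ℕ := fun v => Nat.gcd (v 0) (v 1)
  let pr : (Fin 2 →₀ ℕ) → (Fin 2 →₀ ℕ) := fun v => Finsupp.equivFunOnFinite.symm fun i => v i / gc v
  have hpr_apply : ∀ v i, pr v i = v i / gc v := fun v i => by simp [pr]
  have hgc_pos : ∀ v : Fin 2 →₀ ℕ, v ≠ 0 → 0 < gc v := by
    intro v hv
    by_contra h0
    push Not at h0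
    have h00 : gc v = 0 := Nat.le_zero.mp h0
    have := Nat.gcd_eq_zero_iff.mp h00
    apply hv; ext i; fin_cases i
    · exact this.1
    · exact this.2
  have hdecomp : ∀ v : Fin 2 →₀ ℕ, v ≠ 0 → v = gc v • pr v := by
    intro v hv
    ext i
    rw [Finsupp.smul_apply, smul_eq_mul, hpr_apply]
    have hdvd : gc v ∣ v i := by
      fin_cases i
      · exact Nat.gcd_dvd_left _ _
      · exact Nat.gcd_dvd_right _ _
    exact (Nat.mul_div_cancel' hdvd).symm
  have hpr_ne : ∀ v : Fin 2 →₀ ℕ, v ≠ 0 → pr v ≠ 0 := by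
    intro v hv h0
    apply hv
    rw [hdecomp v hv, h0, smul_zero]
  have hcop : ∀ v : Fin 2 →₀ ℕ, v ≠ 0 → Nat.Coprime (pr v 0) (pr v 1) := by
    intro v hv
    rw [hpr_apply, hpr_apply]
    exact Nat.coprime_div_gcd_div_gcd (hgc_pos v hv)
  -- the set of primitive directions and its enumeration
  set Q : Finset (Fin 2 →₀ ℕ) := (Finset.univ.filter fun j => d j ≠ 0).image fun j => pr (d j) with hQ
  obtain ⟨j₀, hj₀⟩ := hex
  have hQmem : ∀ j, d j ≠ 0 → pr (d j) ∈ Q := fun j hj =>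
    Finset.mem_image.mpr ⟨j, Finset.mem_filter.mpr ⟨Finset.mem_univ j, hj⟩, rfl⟩
  have hspos : 0 < Q.card := Finset.card_pos.mpr ⟨_, hQmem j₀ hj₀⟩
  let enum := Q.equivFin
  let q : Fin Q.card → (Fin 2 →₀ ℕ) := fun e => (enum.symm e).val
  let cl : Fin N → Fin Q.card := fun j => if h : d j ≠ 0 then enum ⟨pr (d j), hQmem j h⟩ else ⟨0, hspos⟩
  refine ⟨Q.card, q, cl, fun j => gc (d j), ?_, ?_, ?_, ?_, ?_⟩
  · calc Q.card ≤ (Finset.univ.filter fun j => d j ≠ 0).card := Finset.card_image_le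
      _ ≤ (Finset.univ : Finset (Fin N)).card := Finset.card_filter_le _ _
      _ = N := by simp
  · intro e
    have hmem : (enum.symm e).val ∈ Q := (enum.symm e).prop
    obtain ⟨j, hj, hjq⟩ := Finset.mem_image.mp hmem
    show (enum.symm e).val ≠ 0
    rw [← hjq]
    exact hpr_ne _ (Finset.mem_filter.mp hj).2
  · intro e
    have hmem : (enum.symm e).val ∈ Q := (enum.symm e).prop
    obtain ⟨j, hj, hjq⟩ := Finset.mem_image.mp hmem
    have hdj : d j ≠ 0 := (Finset.mem_filter.mp hj).2
    refine ⟨j, hdj, ?_⟩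
    show (if h : d j ≠ 0 then enum ⟨pr (d j), hQmem j h⟩ else ⟨0, hspos⟩) = e
    rw [dif_pos hdj]
    have : (⟨pr (d j), hQmem j hdj⟩ : {x // x ∈ Q}) = enum.symm e := Subtype.ext hjq
    rw [this, Equiv.apply_symm_apply]
  · intro j hj
    refine ⟨hgc_pos _ hj, ?_⟩
    show d j = gc (d j) • (enum.symm (if h : d j ≠ 0 then enum ⟨pr (d j), hQmem j h⟩ else ⟨0, hspos⟩)).val
    rw [dif_pos hj, Equiv.symm_apply_apply]
    exact hdecomp _ hj
  · intro e e' hne hpar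
    apply hne
    have hmem : (enum.symm e).val ∈ Q := (enum.symm e).prop
    have hmem' : (enum.symm e').val ∈ Q := (enum.symm e').prop
    obtain ⟨j, hj, hjq⟩ := Finset.mem_image.mp hmem
    obtain ⟨j', hj', hjq'⟩ := Finset.mem_image.mp hmem'
    have hdj : d j ≠ 0 := (Finset.mem_filter.mp hj).2
    have hdj' : d j' ≠ 0 := (Finset.mem_filter.mp hj').2
    change (enum.symm e).val 0 * (enum.symm e').val 1 = (enum.symm e).val 1 * (enum.symm e').val 0 at hpar
    rw [← hjq, ← hjq'] at hpar
    obtain ⟨h0, h1⟩ := eq_of_coprime_of_parallel (hcop _ hdj) (hcop _ hdj') (by rw [hpar, mul_comm])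
    have hvv : pr (d j) = pr (d j') := by
      ext i; fin_cases i
      · exact h0
      · exact h1
    have : enum.symm e = enum.symm e' := Subtype.ext (by rw [← hjq, ← hjq', hvv])
    exact enum.symm.injective this

/-! ## The flip identity -/

/-- Scalars pull out of finite products in the Laurent algebra. [folklore] -/
theorem prod_smul_mul {ι : Type*} (t : Finset ι) (β : ι → ℂ) (x : ι → Laurent) :
    ∏ i ∈ t, β i • x i = (∏ i ∈ t, β i) • ∏ i ∈ t, x i := by
  classical
  induction t using Finset.induction_on with
  | empty => simp
  | insert a t ha ih => rw [Finset.prod_insert ha, Finset.prod_insert ha, Finset.prod_insert ha, ih, smul_mul_smul_comm]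

/-- Products of monomials. [folklore] -/
theorem prod_T {ι : Type*} (t : Finset ι) (z : ι → Fin 2 → ℤ) : ∏ i ∈ t, T (z i) = T (∑ i ∈ t, z i) := by
  classical
  induction t using Finset.induction_on with
  | empty => simp [T_zero]
  | insert a t ha ih => rw [Finset.prod_insert ha, Finset.sum_insert ha, ih, T_mul_T]

/-- One binomial in the Laurent algebra: `toLaurent (1 - ρ X^d) = 1 - ρ • X^d`. [folklore] -/
theorem toLaurent_binomial (ρ : ℂ) (dd : Fin 2 →₀ ℕ) :
    toLaurent (1 - MvPolynomial.C ρ * MvPolynomial.monomial dd 1) = 1 - ρ • T (expZ dd) := by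
  rw [map_sub, map_one, map_mul, toLaurent_C, toLaurent_monomial, one_smul, smul_mul_assoc, one_mul]

/-- **One flipped binomial**: `1 - ρ X^d = (-ρ) • X^d · (1 + (-ρ)⁻¹ s^g)(X^E)` when `d = g q` and `E = -q`.
[folklore] -/
theorem binomial_flipped (ρ : ℂ) (hρ : ρ ≠ 0) (dd qq : Fin 2 →₀ ℕ) (g : ℕ) (h : dd = g • qq) :
    (1 : Laurent) - ρ • T (expZ dd) =
      (-ρ) • (T (expZ dd) * Polynomial.aeval (T (-expZ qq)) (1 + Polynomial.C ((-ρ)⁻¹) * Polynomial.X ^ g)) := by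
  have hneg : -ρ ≠ 0 := neg_ne_zero.mpr hρ
  rw [map_add, map_one, map_mul, Polynomial.aeval_C, map_pow, Polynomial.aeval_X, T_pow,
    Algebra.algebraMap_eq_smul_one, smul_mul_assoc, one_mul, mul_add, mul_one, mul_smul_comm, T_mul_T]
  have hz : expZ dd + (g : ℤ) • -expZ qq = 0 := by
    rw [h, map_nsmul, smul_neg, ← natCast_zsmul, add_neg_cancel]
  rw [hz, T_zero, smul_add, smul_smul, mul_inv_cancel₀ hneg, one_smul, neg_smul, sub_eq_neg_add]

/-- **One unflipped binomial**: `1 - ρ X^d = (1 + (-ρ) s^g)(X^q)` when `d = g q`. [folklore] -/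
theorem binomial_unflipped (ρ : ℂ) (dd qq : Fin 2 →₀ ℕ) (g : ℕ) (h : dd = g • qq) :
    (1 : Laurent) - ρ • T (expZ dd) =
      Polynomial.aeval (T (expZ qq)) (1 + Polynomial.C (-ρ) * Polynomial.X ^ g) := by
  rw [map_add, map_one, map_mul, Polynomial.aeval_C, map_pow, Polynomial.aeval_X, T_pow,
    Algebra.algebraMap_eq_smul_one, smul_mul_assoc, one_mul, h, map_nsmul, natCast_zsmul, neg_smul,
    sub_eq_add_neg]

/-- **THE FLIP IDENTITY** (see the file header). [folklore; Lines/binomial-normal-form-ltc.md §2] -/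
theorem flip_identity {N s : ℕ} (c : ℂ) (ρ : Fin N → ℂ) (d : Fin N → Fin 2 →₀ ℕ) (q : Fin s → Fin 2 →₀ ℕ)
    (cl : Fin N → Fin s) (g : Fin N → ℕ) (hcl : ∀ j, d j ≠ 0 → d j = g j • q (cl j)) (SL : Finset (Fin s)) :
    toLaurent (MvPolynomial.C c * ∏ j, (1 - MvPolynomial.C (ρ j) * MvPolynomial.monomial (d j) 1)) =
      (c * ∏ j, (if d j = 0 then 1 - ρ j else if ρ j = 0 then 1 else if cl j ∈ SL then -ρ j else 1)) •
        (T (expZ (∑ j ∈ Finset.univ.filter (fun j => d j ≠ 0 ∧ ρ j ≠ 0 ∧ cl j ∈ SL), d j)) *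
          ∏ e, Polynomial.aeval (T (if e ∈ SL then -expZ (q e) else expZ (q e)))
            (∏ j ∈ Finset.univ.filter (fun j => d j ≠ 0 ∧ ρ j ≠ 0 ∧ cl j = e),
              (1 + Polynomial.C (if cl j ∈ SL then (-ρ j)⁻¹ else -ρ j) * Polynomial.X ^ g j))) := by
  classical
  -- uniform factorisation of each binomial: `b_j = β_j • (X^{z_j} · φ_j(X^{E_{cl j}}))`
  set E : Fin s → Fin 2 → ℤ := fun e => if e ∈ SL then -expZ (q e) else expZ (q e) with hE
  set β : Fin N → ℂ := fun j => if d j = 0 then 1 - ρ j else if ρ j = 0 then 1 else if cl j ∈ SL then -ρ j else 1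
    with hβ
  set z : Fin N → Fin 2 → ℤ := fun j => if d j ≠ 0 ∧ ρ j ≠ 0 ∧ cl j ∈ SL then expZ (d j) else 0 with hz
  set φ : Fin N → ℂ[X] := fun j => if d j ≠ 0 ∧ ρ j ≠ 0 then
      1 + Polynomial.C (if cl j ∈ SL then (-ρ j)⁻¹ else -ρ j) * Polynomial.X ^ g j else 1 with hφ
  have hfac : ∀ j, toLaurent (1 - MvPolynomial.C (ρ j) * MvPolynomial.monomial (d j) 1) =
      β j • (T (z j) * Polynomial.aeval (T (E (cl j))) (φ j)) := by
    intro j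
    rw [toLaurent_binomial]
    by_cases hd : d j = 0
    · simp only [hβ, hz, hφ, hd, if_true, ne_eq, not_true_eq_false, false_and, if_false, map_one, mul_one,
        map_zero, T_zero]
      rw [sub_smul, one_smul]
    by_cases hρ : ρ j = 0
    · simp only [hβ, hz, hφ, hd, hρ, if_true, if_false, ne_eq, not_true_eq_false, and_false, false_and,
        not_false_eq_true, map_one, mul_one, one_smul, T_zero, zero_smul, sub_zero]
    by_cases hS : cl j ∈ SL
    · simp only [hβ, hz, hφ, hE, hd, hρ, hS, if_true, if_false, ne_eq, not_false_eq_true, and_self]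
      exact binomial_flipped (ρ j) hρ (d j) (q (cl j)) (g j) (hcl j hd)
    · simp only [hβ, hz, hφ, hE, hd, hρ, hS, if_true, if_false, ne_eq, not_false_eq_true, and_self,
        and_false, one_smul, T_zero, one_mul]
      exact binomial_unflipped (ρ j) (d j) (q (cl j)) (g j) (hcl j hd)
  rw [map_mul, toLaurent_C, map_prod, Finset.prod_congr rfl fun j _ => hfac j, prod_smul_mul,
    Finset.prod_mul_distrib, prod_T, smul_mul_assoc, one_mul, smul_smul]
  congr 1
  congr 1
  · -- the corner: `Σ z_j`
    congr 1
    rw [hz, ← Finset.sum_filter, map_sum]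
  · -- regroup the univariate factors by lines
    rw [← Finset.prod_fiberwise_of_maps_to (g := cl) (fun j _ => Finset.mem_univ (cl j))]
    refine Finset.prod_congr rfl fun e _ => ?_
    rw [map_prod]
    rw [show (Finset.univ.filter fun j => d j ≠ 0 ∧ ρ j ≠ 0 ∧ cl j = e) =
        (Finset.univ.filter fun j => cl j = e).filter (fun j => d j ≠ 0 ∧ ρ j ≠ 0) from by
      ext j; simp only [Finset.mem_filter, Finset.mem_univ, true_and]; tauto]
    conv_rhs => rw [Finset.prod_filter]
    refine Finset.prod_congr rfl fun j hj => ?_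
    have hje : cl j = e := (Finset.mem_filter.mp hj).2
    subst hje
    rw [hφ]
    simp only [hE]
    split_ifs <;> first | rfl | exact map_one _

/-! ## The line factors -/

/-- The line factors have constant term `1` (every `g_j ≥ 1`). [folklore] -/
theorem coeff_lineFactor_zero {N : ℕ} (t : Finset (Fin N)) (a : Fin N → ℂ) (g : Fin N → ℕ)
    (hg : ∀ j ∈ t, 1 ≤ g j) : (∏ j ∈ t, (1 + Polynomial.C (a j) * Polynomial.X ^ g j)).coeff 0 = 1 := by
  rw [Polynomial.coeff_zero_eq_eval_zero, Polynomial.eval_prod]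
  refine Finset.prod_eq_one fun j hj => ?_
  have : g j ≠ 0 := by have := hg j hj; omega
  rw [Polynomial.eval_add, Polynomial.eval_one, Polynomial.eval_mul, Polynomial.eval_C, Polynomial.eval_pow,
    Polynomial.eval_X, zero_pow this, mul_zero, add_zero]

/-- The line factors have degree at most the sum of the multiplicities. [folklore] -/
theorem natDegree_lineFactor_le {N : ℕ} (t : Finset (Fin N)) (a : Fin N → ℂ) (g : Fin N → ℕ) :
    (∏ j ∈ t, (1 + Polynomial.C (a j) * Polynomial.X ^ g j)).natDegree ≤ ∑ j ∈ t, g j := by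
  refine (Polynomial.natDegree_prod_le t _).trans (Finset.sum_le_sum fun j _ => ?_)
  refine (Polynomial.natDegree_add_le _ _).trans (max_le ?_ (Polynomial.natDegree_C_mul_X_pow_le (a j) (g j)))
  rw [Polynomial.natDegree_one]; exact Nat.zero_le _

end K3Pi

end Summit.ValiantsHypothesis.ValiantsHypothesis.Theorems.NewtonUnitEquationsNewtonTauWeak

end
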